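import Mathlib
import Summits.CriticalPhenomena.SAWScalingLimit.Theorems.SAWRestrictionRigidityAxiomsOfLimitMarkovPathAnnouncing
import Summits.CriticalPhenomena.SAWScalingLimit.Theorems.SAWRestrictionRigidityAxiomsOfLimitMarkovPathTraceEq
import Summits.CriticalPhenomena.SAWScalingLimit.Theorems.SAWRestrictionRigidityAxiomsOfLimitMarkovAnnouncingIdentification
import HarnessLib

/-!
# The conditional expectation given the path stopped at a hitting time is a martingale left limit

Crux `AxiomsOfLimit` (stmt-CriticalPhenomena-1370), line `registered` (= `split`), stub `stub_markovOfLimit`: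
soft-Markov line, theorem (P) — composition of the landed bricks P1a (`stub_announcingOnPathSpace`, p160978),
P1b (`stub_traceEqOnPathSpace`, p160668) and SM5a (`ae_tendsto_condExp_of_announcing`, p158942) (lead c4).
Theorems only.

On the path space `C([0,1], ℂ)` with the canonical filtration `𝔽 t = σ(path stopped at t)` (given abstractly with
the hypothesis `h𝔽`), for a closed set `F`, a finite measure `μ` and ANY real function `ξ` on paths:

* `ae_tendsto_condExp_preHitting_of_hits` — for `μ`-a.e. path `ω` that starts outside `F` and meets `F`, the
  rational martingale `q ↦ μ[ξ | 𝔽 q] ω` tends, as `q ↑ τ_F ω`, to `μ[ξ | ℋ_F] ω`, where `ℋ_F` is the σ-algebra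
  generated by the path stopped at its hitting parameter `τ_F` of `F` (announcing events of measure `≥ 1 − 1/(j+1)`
  exhaust the hit event);
* `iSup_pathFiltration_eq`, `ae_tendsto_condExp_nhdsLT_one` — `⨆_{q<1} 𝔽 q` is the whole Borel σ-algebra
  (a path is the uniform limit of its stopped versions), so the rational martingale tends to `ξ` itself as `q ↑ 1`
  (Lévy upward + existence of left limits);
* `ae_tendsto_condExp_preHitting` — the two cases together: for a.e. path starting outside `F` the martingale
  left limit at `τ_F` IS the conditional expectation given the stopped path (paths never meeting `F` have
  `τ_F = 1`, `ℋ_F`-trace = Borel trace on that event).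

This is the predictable-projection identity `E[ξ | 𝓕_{τ−}] = M^ξ_{τ−}` at the announceable time `τ_F`, with an
`F`-INDEPENDENT right-hand side: the kernel of the domain-Markov property will be read off the single process
of martingale left limits. References: C. Dellacherie, P.-A. Meyer, *Probabilités et potentiel* B, VI.43–45;
O. Kallenberg, *Foundations of Modern Probability* (2002), Lemma 25.2. All [folklore].
-/

noncomputable section

open MeasureTheory Filter Topology Set

namespace Summit.CriticalPhenomena.SAWScalingLimit.Theorems.AxiomsOfLimitMarkov

open Literature.Probability.RandomPlanarGeometry

/-- The path `ω` stopped at real time `t`: `u ↦ ω (min u (projIcc t))`. [folklore] -/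
local notation3 "stp[" t ", " ω "]" =>
  ContinuousMap.comp ω (ContinuousMap.id unitInterval ⊓
    ContinuousMap.const unitInterval (Set.projIcc (0:ℝ) 1 zero_le_one t))

/-- The hitting parameter of `F` by the path `ω`. [folklore] -/
local notation3 "hit[" F ", " ω "]" => Curve.hitParam F (Curve.mk ω)

section PathSpace

variable [MeasurableSpace C(unitInterval, ℂ)] [BorelSpace C(unitInterval, ℂ)]

omit [MeasurableSpace C(unitInterval, ℂ)] [BorelSpace C(unitInterval, ℂ)] in
/-- The stopping map `(t, ω) ↦ ω stopped at t` is jointly continuous. [folklore] -/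
theorem continuous_stop_uncurry :
    Continuous fun p : ℝ × C(unitInterval, ℂ) => stp[p.1, p.2] :=
  ContinuousMap.continuous_comp'.comp ((continuous_stopClock.comp continuous_fst).prodMk continuous_snd)

/-- Stopping at a measurable random time is a Borel map of the path. [folklore] -/
theorem measurable_stop_random {τ : C(unitInterval, ℂ) → ℝ} (hτ : Measurable τ) :
    Measurable fun ω : C(unitInterval, ℂ) => stp[τ ω, ω] :=
  continuous_stop_uncurry.measurable.comp (hτ.prodMk measurable_id)

/-- The σ-algebra of the path stopped at its hitting parameter of a closed set is a sub-σ-algebra of the Borel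
σ-algebra. [folklore] -/
theorem comap_stop_hit_le {F : Set ℂ} (hF : IsClosed F) :
    MeasurableSpace.comap (fun ω : C(unitInterval, ℂ) => stp[hit[F, ω], ω]) inferInstance ≤
      (inferInstance : MeasurableSpace C(unitInterval, ℂ)) :=
  (measurable_stop_random (Curve.measurable_hitParam_mk hF)).comap_le

/-- **Pre-hitting identification on the hit event.** For `μ`-a.e. path starting outside the closed set `F` and
meeting `F`, the rational martingale `q ↦ μ[ξ | 𝔽 q] ω` converges, as `q ↑ τ_F ω`, to the conditional
expectation of `ξ` given the path stopped at `τ_F`. (P1a + P1b + SM5a on announcing events of measure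
`≥ μ(hit event) − 1/(j+1)`, `j → ∞`.) [folklore] -/
theorem ae_tendsto_condExp_preHitting_of_hits
    (𝔽 : Filtration ℝ (inferInstance : MeasurableSpace C(unitInterval, ℂ)))
    (h𝔽 : ∀ t : ℝ, 𝔽 t = MeasurableSpace.comap (fun ω : C(unitInterval, ℂ) => stp[t, ω]) inferInstance)
    (μ : Measure C(unitInterval, ℂ)) [IsFiniteMeasure μ] {F : Set ℂ} (hF : IsClosed F)
    (ξ : C(unitInterval, ℂ) → ℝ) :
    ∀ᵐ ω ∂μ, ω 0 ∉ F → (∃ t, ω t ∈ F) → Tendsto (fun q : ℚ => μ[ξ|𝔽 (q : ℝ)] ω)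
      (comap (fun q : ℚ => (q : ℝ)) (𝓝[<] hit[F, ω]))
      (𝓝 (μ[ξ|MeasurableSpace.comap (fun ω : C(unitInterval, ℂ) => stp[hit[F, ω], ω]) inferInstance] ω)) := by
  -- for each `j`, the conclusion holds a.e. on an announcing event `B j` missing at most `1/(j+1)` of the hit event
  have key : ∀ j : ℕ, ∃ B : Set C(unitInterval, ℂ),
      μ ({ω : C(unitInterval, ℂ) | ω 0 ∉ F ∧ ∃ t, ω t ∈ F} \ B) ≤ ENNReal.ofReal (1 / ((j : ℝ) + 1)) ∧
      ∀ᵐ ω ∂μ, ω ∈ B → Tendsto (fun q : ℚ => μ[ξ|𝔽 (q : ℝ)] ω)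
        (comap (fun q : ℚ => (q : ℝ)) (𝓝[<] hit[F, ω]))
        (𝓝 (μ[ξ|MeasurableSpace.comap (fun ω : C(unitInterval, ℂ) => stp[hit[F, ω], ω]) inferInstance] ω)) := by
    intro j
    obtain ⟨σ, B, hσ, hrat, hmono, hle1, hlt, hlim, hBℋ, hB𝒢, hfac, hμ⟩ :=
      stub_announcingOnPathSpace 𝔽 h𝔽 μ F hF (1 / ((j : ℝ) + 1)) (by positivity)
    refine ⟨B, hμ, ?_⟩
    have htrace := stub_traceEqOnPathSpace 𝔽 h𝔽 F hF σ hσ hrat hmono hle1 B hlt hlim hBℋ hB𝒢 hfac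
    exact ae_tendsto_condExp_of_announcing μ 𝔽 ξ σ hσ hrat hmono ⟨1, hle1⟩ (fun ω => hit[F, ω]) B hlt
      hlim _ (comap_stop_hit_le hF) hBℋ hB𝒢 htrace
  choose B hBμ hBae using key
  -- a.e. path of the hit event lies in some `B j`
  have hnull : μ ({ω : C(unitInterval, ℂ) | ω 0 ∉ F ∧ ∃ t, ω t ∈ F} \ ⋃ j, B j) = 0 := by
    refine le_antisymm ?_ bot_le
    have hlim0 : Tendsto (fun j : ℕ => ENNReal.ofReal (1 / ((j : ℝ) + 1))) atTop (𝓝 0) := by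
      rw [← ENNReal.ofReal_zero]
      exact ENNReal.tendsto_ofReal tendsto_one_div_add_atTop_nhds_zero_nat
    refine ge_of_tendsto' hlim0 fun j => (measure_mono ?_).trans (hBμ j)
    exact fun ω hω => ⟨hω.1, fun h => hω.2 (mem_iUnion.2 ⟨j, h⟩)⟩
  have hG : ∀ᵐ ω ∂μ, (ω 0 ∉ F ∧ ∃ t, ω t ∈ F) → ∃ j, ω ∈ B j := by
    rw [ae_iff]
    refine measure_mono_null (fun ω hω => ?_) hnull
    simp only [not_exists, Classical.not_imp, mem_setOf_eq] at hω
    exact ⟨hω.1, by simpa only [mem_iUnion, not_exists] using hω.2⟩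
  filter_upwards [ae_all_iff.2 hBae, hG] with ω hall hex h0 hhit
  obtain ⟨j, hj⟩ := hex ⟨h0, hhit⟩
  exact hall j hj

/-- **The canonical filtration exhausts the Borel σ-algebra before time `1`**: every Borel set of paths is
measurable for `⨆ n, 𝔽 (1 - 1/(n+1))` (a path is the uniform limit of its versions stopped at `1 - 1/(n+1)`,
and stopped paths are adapted). [folklore] -/
theorem le_iSup_pathFiltration
    (𝔽 : Filtration ℝ (inferInstance : MeasurableSpace C(unitInterval, ℂ)))
    (h𝔽 : ∀ t : ℝ, 𝔽 t = MeasurableSpace.comap (fun ω : C(unitInterval, ℂ) => stp[t, ω]) inferInstance) :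
    (inferInstance : MeasurableSpace C(unitInterval, ℂ)) ≤ ⨆ n : ℕ, 𝔽 (1 - 1 / ((n : ℝ) + 1)) := by
  -- the identity is the pointwise limit of the stopped paths, each measurable for the supremum
  have hmeas : ∀ n : ℕ, Measurable[⨆ n : ℕ, 𝔽 (1 - 1 / ((n : ℝ) + 1))]
      (fun ω : C(unitInterval, ℂ) => stp[1 - 1 / ((n : ℝ) + 1), ω]) := by
    intro n
    have h1 : Measurable[𝔽 (1 - 1 / ((n : ℝ) + 1))]
        (fun ω : C(unitInterval, ℂ) => stp[1 - 1 / ((n : ℝ) + 1), ω]) := by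
      rw [h𝔽]
      exact comap_measurable _
    exact h1.mono (le_iSup (fun n : ℕ => 𝔽 (1 - 1 / ((n : ℝ) + 1))) n) le_rfl
  have hlim : Tendsto (fun n : ℕ => fun ω : C(unitInterval, ℂ) => stp[1 - 1 / ((n : ℝ) + 1), ω]) atTop
      (𝓝 fun ω => ω) := by
    rw [tendsto_pi_nhds]
    intro ω
    have h1 : stp[(1 : ℝ), ω] = ω := by
      refine ContinuousMap.ext fun u => ?_
      simp only [ContinuousMap.comp_apply, ContinuousMap.inf_apply, ContinuousMap.id_apply,
        ContinuousMap.const_apply, Set.projIcc_right]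
      exact congrArg ω (inf_eq_left.2 (unitInterval.le_one u))
    have ht : Tendsto (fun n : ℕ => (1 : ℝ) - 1 / ((n : ℝ) + 1)) atTop (𝓝 1) := by
      simpa only [sub_zero] using (tendsto_const_nhds (x := (1 : ℝ))).sub
        tendsto_one_div_add_atTop_nhds_zero_nat
    have h2 := ((continuous_stop ω).tendsto 1).comp ht
    rw [h1] at h2
    exact h2
  have hid : Measurable[⨆ n : ℕ, 𝔽 (1 - 1 / ((n : ℝ) + 1))] (fun ω : C(unitInterval, ℂ) => ω) :=
    @measurable_of_tendsto_metrizable _ _ (⨆ n : ℕ, 𝔽 (1 - 1 / ((n : ℝ) + 1))) _ _ _ _ _ _ hmeas hlim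
  intro s hs
  exact hid hs

/-- **The rational martingale tends to `ξ` at time `1`.** For every real `ξ` and finite `μ`: for `μ`-a.e. path,
`μ[ξ | 𝔽 q] ω → μ[ξ | Borel] ω` as `q ↑ 1` along rationals (Lévy's upward theorem along `1 - 1/(n+1)`, the
exhaustion `le_iSup_pathFiltration`, and the existence of left limits `ae_forall_exists_tendsto_condExp_ratCast`).
[folklore] -/
theorem ae_tendsto_condExp_nhdsLT_one
    (𝔽 : Filtration ℝ (inferInstance : MeasurableSpace C(unitInterval, ℂ)))
    (h𝔽 : ∀ t : ℝ, 𝔽 t = MeasurableSpace.comap (fun ω : C(unitInterval, ℂ) => stp[t, ω]) inferInstance)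
    (μ : Measure C(unitInterval, ℂ)) [IsFiniteMeasure μ] (ξ : C(unitInterval, ℂ) → ℝ) :
    ∀ᵐ ω ∂μ, Tendsto (fun q : ℚ => μ[ξ|𝔽 (q : ℝ)] ω) (comap (fun q : ℚ => (q : ℝ)) (𝓝[<] (1 : ℝ)))
      (𝓝 (μ[ξ|(inferInstance : MeasurableSpace C(unitInterval, ℂ))] ω)) := by
  -- Lévy upward along the deterministic times `1 - 1/(n+1)` (rational!)
  let 𝒢 : Filtration ℕ (inferInstance : MeasurableSpace C(unitInterval, ℂ)) :=
    ⟨fun n => 𝔽 (1 - 1 / ((n : ℝ) + 1)), fun m n hmn => 𝔽.mono (by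
        have : (1 : ℝ) / ((n : ℝ) + 1) ≤ 1 / ((m : ℝ) + 1) :=
          one_div_le_one_div_of_le (by positivity) (by exact_mod_cast Nat.succ_le_succ hmn)
        linarith), fun n => 𝔽.le _⟩
  have hsup : (⨆ n, 𝒢 n) = (inferInstance : MeasurableSpace C(unitInterval, ℂ)) :=
    le_antisymm (iSup_le fun n => 𝔽.le _) (le_iSup_pathFiltration 𝔽 h𝔽)
  have hLevy : ∀ᵐ ω ∂μ, Tendsto (fun n => μ[ξ|𝒢 n] ω) atTop
      (𝓝 (μ[ξ|(inferInstance : MeasurableSpace C(unitInterval, ℂ))] ω)) := by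
    have := tendsto_ae_condExp (ℱ := 𝒢) (μ := μ) ξ
    rw [hsup] at this
    exact this
  -- left limits along rationals exist everywhere
  let ℱℚ : Filtration ℚ (inferInstance : MeasurableSpace C(unitInterval, ℂ)) :=
    ⟨fun q => 𝔽 (q : ℝ), fun _ _ h => 𝔽.mono (Rat.cast_le.2 h), fun q => 𝔽.le _⟩
  have hleft := ae_forall_exists_tendsto_condExp_ratCast μ ℱℚ ξ
  filter_upwards [hLevy, hleft] with ω hL hl
  obtain ⟨L, hLlim⟩ := hl 1
  -- the rational times `q n := 1 - 1/(n+1)` tend to `1` from the left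
  set qn : ℕ → ℚ := fun n => 1 - 1 / ((n : ℚ) + 1) with hqn
  have hcast : ∀ n, ((qn n : ℚ) : ℝ) = 1 - 1 / ((n : ℝ) + 1) := fun n => by
    simp only [hqn, Rat.cast_sub, Rat.cast_one, Rat.cast_div, Rat.cast_add, Rat.cast_natCast]
  have hq : Tendsto qn atTop (comap (fun q : ℚ => (q : ℝ)) (𝓝[<] (1 : ℝ))) := by
    rw [tendsto_comap_iff]
    have h1 : Tendsto (fun n : ℕ => (1 : ℝ) - 1 / ((n : ℝ) + 1)) atTop (𝓝[<] 1) := by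
      refine tendsto_nhdsWithin_iff.2 ⟨?_, Eventually.of_forall fun n => ?_⟩
      · simpa only [sub_zero] using (tendsto_const_nhds (x := (1 : ℝ))).sub
          tendsto_one_div_add_atTop_nhds_zero_nat
      · simp only [mem_Iio, sub_lt_self_iff]
        positivity
    refine h1.congr fun n => ?_
    simp only [Function.comp_apply, hcast]
  have hsame : ∀ n, μ[ξ|ℱℚ (qn n)] ω = μ[ξ|𝒢 n] ω := fun n => by
    change μ[ξ|𝔽 ((qn n : ℚ) : ℝ)] ω = μ[ξ|𝔽 (1 - 1 / ((n : ℝ) + 1))] ω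
    rw [hcast]
  have hL' : Tendsto (fun n => μ[ξ|ℱℚ (qn n)] ω) atTop
      (𝓝 (μ[ξ|(inferInstance : MeasurableSpace C(unitInterval, ℂ))] ω)) := by
    simp only [hsame]; exact hL
  have hLq : Tendsto (fun n => μ[ξ|ℱℚ (qn n)] ω) atTop (𝓝 L) := hLlim.comp hq
  rwa [tendsto_nhds_unique hLq hL'] at hLlim

/-- On the event of paths never meeting `F` (where `τ_F = 1` and stopping does nothing), the σ-algebra of the
path stopped at `τ_F` has the same trace as the Borel σ-algebra; hence the conditional expectation given the
stopped path is `μ[ξ | Borel]` there. [folklore] -/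
theorem condExp_comap_stop_hit_ae_eq_of_not_hits (μ : Measure C(unitInterval, ℂ)) [IsFiniteMeasure μ]
    {F : Set ℂ} (hF : IsClosed F) (ξ : C(unitInterval, ℂ) → ℝ) :
    ∀ᵐ ω ∂μ, (∀ t, ω t ∉ F) →
      μ[ξ|MeasurableSpace.comap (fun ω : C(unitInterval, ℂ) => stp[hit[F, ω], ω]) inferInstance] ω =
        μ[ξ|(inferInstance : MeasurableSpace C(unitInterval, ℂ))] ω := by
  set T : C(unitInterval, ℂ) → C(unitInterval, ℂ) := fun ω => stp[hit[F, ω], ω] with hT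
  have hTm : Measurable T := measurable_stop_random (Curve.measurable_hitParam_mk hF)
  -- the no-hit event and the identity `T = id` on it
  set N : Set C(unitInterval, ℂ) := {ω | ∀ t, ω t ∉ F} with hN
  have hTid : ∀ ω ∈ N, T ω = ω := by
    intro ω hω
    have h1 : hit[F, ω] = 1 := Curve.hitParam_eq_one_of_forall_notMem hω
    refine ContinuousMap.ext fun u => ?_
    simp only [hT, h1, ContinuousMap.comp_apply, ContinuousMap.inf_apply, ContinuousMap.id_apply,
      ContinuousMap.const_apply, Set.projIcc_right]
    exact congrArg ω (inf_eq_left.2 (unitInterval.le_one u))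
  have hNpre : T ⁻¹' N = N := by
    ext ω
    simp only [mem_preimage]
    constructor
    · intro h t ht
      -- if `ω` met `F`, the stopped path would meet `F` at its hitting parameter
      have hhit : ∃ t, ω t ∈ F := ⟨t, ht⟩
      have hmem := Curve.apply_hitParam_mem hF (γ := Curve.mk ω) hhit
      refine h ⟨hit[F, ω], (Curve.mk ω).hitParam_mem_Icc F⟩ ?_
      simp only [hT, ContinuousMap.comp_apply, ContinuousMap.inf_apply, ContinuousMap.id_apply,
        ContinuousMap.const_apply]
      rw [Set.projIcc_of_mem _ ((Curve.mk ω).hitParam_mem_Icc F), inf_idem]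
      exact hmem
    · intro h
      rw [hTid ω h]
      exact h
  have hNBorel : MeasurableSet N := by
    -- `N = {τ_F = 1} ∩ {ω 1 ∉ F}`
    have hN' : N = {ω : C(unitInterval, ℂ) | hit[F, ω] = 1} ∩ (fun ω : C(unitInterval, ℂ) => ω 1) ⁻¹' Fᶜ := by
      ext ω
      simp only [hN, mem_setOf_eq, mem_inter_iff, mem_preimage, mem_compl_iff]
      constructor
      · intro h
        exact ⟨Curve.hitParam_eq_one_of_forall_notMem h, h 1⟩
      · rintro ⟨h1, h1F⟩ t ht
        have hle : hit[F, ω] ≤ t := Curve.hitParam_le (γ := Curve.mk ω) ht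
        rw [h1] at hle
        have ht1 : t = 1 := Subtype.ext (le_antisymm (unitInterval.le_one t) hle)
        exact h1F (ht1 ▸ ht)
    rw [hN']
    exact (measurableSet_eq_fun (Curve.measurable_hitParam_mk hF) measurable_const).inter
      ((continuous_eval_const (1 : unitInterval)).measurable hF.isOpen_compl.measurableSet)
  -- `N` belongs to the stopped σ-algebra and the traces of the two σ-algebras on `N` coincide
  have hℋle : MeasurableSpace.comap T inferInstance ≤ (inferInstance : MeasurableSpace C(unitInterval, ℂ)) :=
    hTm.comap_le
  have hNℋ : MeasurableSet[MeasurableSpace.comap T inferInstance] N :=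
    ⟨N, hNBorel, hNpre⟩
  have htrace : ∀ t, MeasurableSet[MeasurableSpace.comap T inferInstance] (N ∩ t) ↔ MeasurableSet (N ∩ t) := by
    intro t
    refine ⟨fun h => hℋle _ h, fun h => ⟨N ∩ t, h, ?_⟩⟩
    ext ω
    simp only [mem_preimage, mem_inter_iff]
    constructor
    · rintro ⟨hTN, hTt⟩
      have hωN : ω ∈ N := by rw [← hNpre]; exact hTN
      rw [hTid ω hωN] at hTt
      exact ⟨hωN, hTt⟩
    · rintro ⟨hωN, hωt⟩
      rw [hTid ω hωN]
      exact ⟨hωN, hωt⟩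
  haveI : SigmaFinite (μ.trim hℋle) := by
    haveI : IsFiniteMeasure (μ.trim hℋle) := isFiniteMeasure_trim hℋle
    infer_instance
  have hle0 : (‹MeasurableSpace C(unitInterval, ℂ)› : MeasurableSpace C(unitInterval, ℂ)) ≤
      ‹MeasurableSpace C(unitInterval, ℂ)› := le_rfl
  haveI : SigmaFinite (μ.trim hle0) := by
    haveI : IsFiniteMeasure (μ.trim hle0) := isFiniteMeasure_trim hle0
    infer_instance
  have key := condExp_ae_eq_restrict_of_measurableSpace_eq_on (μ := μ) (f := ξ) hℋle hle0 hNℋ htrace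
  rw [Filter.EventuallyEq, ae_restrict_iff' hNBorel] at key
  filter_upwards [key] with ω hω hωN
  exact hω hωN

/-- **Pre-hitting identification (both cases).** For every finite measure `μ` on paths, closed `F` and real
function `ξ`: for `μ`-a.e. path `ω` starting outside `F`, the rational martingale `q ↦ μ[ξ | 𝔽 q] ω` converges,
as `q ↑ τ_F ω` along rationals, to `μ[ξ | σ(path stopped at τ_F)] ω` — on the hit event by
`ae_tendsto_condExp_preHitting_of_hits`, and for paths never meeting `F` (`τ_F = 1`) by
`ae_tendsto_condExp_nhdsLT_one` and `condExp_comap_stop_hit_ae_eq_of_not_hits`. The right-hand side is a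
conditional expectation given the PAST; the left-hand side does not depend on `F`. [folklore] -/
theorem ae_tendsto_condExp_preHitting
    (𝔽 : Filtration ℝ (inferInstance : MeasurableSpace C(unitInterval, ℂ)))
    (h𝔽 : ∀ t : ℝ, 𝔽 t = MeasurableSpace.comap (fun ω : C(unitInterval, ℂ) => stp[t, ω]) inferInstance)
    (μ : Measure C(unitInterval, ℂ)) [IsFiniteMeasure μ] {F : Set ℂ} (hF : IsClosed F)
    (ξ : C(unitInterval, ℂ) → ℝ) :
    ∀ᵐ ω ∂μ, ω 0 ∉ F → Tendsto (fun q : ℚ => μ[ξ|𝔽 (q : ℝ)] ω)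
      (comap (fun q : ℚ => (q : ℝ)) (𝓝[<] hit[F, ω]))
      (𝓝 (μ[ξ|MeasurableSpace.comap (fun ω : C(unitInterval, ℂ) => stp[hit[F, ω], ω]) inferInstance] ω)) := by
  filter_upwards [ae_tendsto_condExp_preHitting_of_hits 𝔽 h𝔽 μ hF ξ, ae_tendsto_condExp_nhdsLT_one 𝔽 h𝔽 μ ξ,
    condExp_comap_stop_hit_ae_eq_of_not_hits μ hF ξ] with ω hhit h1 hno h0
  by_cases h : ∃ t, ω t ∈ F
  · exact hhit h0 h
  · push Not at h
    rw [Curve.hitParam_eq_one_of_forall_notMem h, hno h]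
    exact h1

end PathSpace

/-! ### Registered sub-goal of crux stmt-CriticalPhenomena-1370 (line `registered`, stub `stub_markovOfLimit`) -/

section Registered

/-- **Registered sub-goal `stub_preHittingIdentification`** (crux stmt-CriticalPhenomena-1370, soft-Markov line, theorem
(P)): `ae_tendsto_condExp_preHitting` with all binders explicit and notation-free — on the path space with its canonical
filtration, for every finite measure, closed `F` and real `ξ`, for a.e. path starting outside `F` the rational martingale
`q ↦ E[ξ | 𝔽 q]` converges as `q ↑ τ_F` to `E[ξ | σ(path stopped at τ_F)]`. [folklore] -/
theorem stub_preHittingIdentification :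
    ∀ [MeasurableSpace C(unitInterval, ℂ)] [BorelSpace C(unitInterval, ℂ)] (𝔽 : MeasureTheory.Filtration ℝ (inferInstance : MeasurableSpace C(unitInterval, ℂ))), (∀ t : ℝ, 𝔽 t = MeasurableSpace.comap (fun ω : C(unitInterval, ℂ) => ((ω).comp (ContinuousMap.id unitInterval ⊓ ContinuousMap.const unitInterval (Set.projIcc (0:ℝ) 1 zero_le_one (t))))) inferInstance) → ∀ (μ : MeasureTheory.Measure C(unitInterval, ℂ)) [MeasureTheory.IsFiniteMeasure μ] (F : Set ℂ), IsClosed F → ∀ ξ : C(unitInterval, ℂ) → ℝ, Filter.Eventually (fun ω : C(unitInterval, ℂ) => ω 0 ∉ F → Filter.Tendsto (fun q : ℚ => MeasureTheory.condExp (𝔽 (q : ℝ)) μ ξ ω) (Filter.comap (fun q : ℚ => (q : ℝ)) (nhdsWithin ((Literature.Probability.RandomPlanarGeometry.Curve.mk (ω)).hitParam F) (Set.Iio ((Literature.Probability.RandomPlanarGeometry.Curve.mk (ω)).hitParam F)))) (nhds (MeasureTheory.condExp (MeasurableSpace.comap (fun ω : C(unitInterval, ℂ) => ((ω).comp (ContinuousMap.id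 unitInterval ⊓ ContinuousMap.const unitInterval (Set.projIcc (0:ℝ) 1 zero_le_one (((Literature.Probability.RandomPlanarGeometry.Curve.mk (ω)).hitParam F)))))) inferInstance) μ ξ ω))) (MeasureTheory.ae μ) :=
  fun 𝔽 h𝔽 μ _ _ hF ξ => ae_tendsto_condExp_preHitting 𝔽 h𝔽 μ hF ξ

end Registered

end Summit.CriticalPhenomena.SAWScalingLimit.Theorems.AxiomsOfLimitMarkov

end
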